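import Summits.Ventures.PercRepro.RankLevelSetBiIndepAbsorbPaving
import Summits.Ventures.PercRepro.RankLevelSetBoolInOut

/-! # RankLevelSetBiIndepAbsorbStar — (ABS-star): THE STAR-NORMALIZED STEP OF THE ABSORBING PROFILE,
`(#E − 1 − k) · A^y_k ≤ k · A^y_{k+1}` FOR `2k + 1 ≤ #E` — THE `Prop`, ITS RUNGS ((ABS-star) ⟹ THE STEP OF (ABS-norm),
(ABS-star) ∧ (★★)⁺ ⟹ (ABS-norm)), AND THE PAVING CASE (night-1 g33; dossier §45.10)

For the free matroid the step of the Boolean (IO) is implied by the STAR-NORMALIZED step `(n − k) v_k ≤ k v_{k+1}`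
(`RankLevelSetBoolInOutStrong`). For a matroid `M` on `n = #E` elements and a non-loop `y`, the absorbing avoid-`y`
profile `A^y` (g28/g32, `lowAbsorbCount`) is the in-out profile of the cut of `y` in `M ＼ {y}` (g32), a matroid on
`n − 1` elements; the corresponding statement is **(ABS-star)**: `(n − 1 − k) · A^y_k ≤ k · A^y_{k+1}` for
`2k + 1 ≤ n` — the density of `A^y` relative to the star `C(n − 2, k − 1)` is nondecreasing up to the middle.
CENSUS (night-1 g33, own exact code, mining/night-1/g33/strongstep.py and kit j322624): every matroid with ≤ 8
elements and every non-loop, 37,044 steps, 0 failures; ALL of `n = 9`: 1,719,270 `(M, y)` instances, 8,596,350 steps,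
0 FAILURES (8,758 equalities with `A_k > 0`); planted controls fire. It is STRICTLY stronger than the step of (ABS-norm)
below the middle and implies it (**`absorbStep_of_absorbStar`**), with `A^y_k ≤ A^y_{k+1}` (**`lowAbsorbCount_le_succ`**);
together with (★★)⁺ it gives (ABS-norm) (**`absorbNormSkew_of_absorbStar`**: the steps and the reflections are all
of `NormSkew`). EVERY PAVING MATROID satisfies (ABS-star) (**`absorbStar_of_paving`**: the only non-vacuous step is
`(r − 1, r)` on `2r − 1` elements, where it is g32's injection). Nothing here asserts (ABS-star); every declaration
has a docstring; imports: the cell's own modules and Mathlib only. Axioms: standard. -/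

namespace PercRepro

open Set Matroid

variable {α : Type} (M : Matroid α) [M.Finite]

omit [M.Finite] in
/-- **(ABS-star)** (night-1 g33; a `Prop`, NOT asserted): for every element `y` and every `k` with `2k + 1 ≤ #E`,
`(#E − 1 − k) · A^y_k ≤ k · A^y_{k+1}`. Census-clean on every matroid with ≤ 9 elements (dossier §45.10). -/
def BiIndepAbsorbStar : Prop :=
  ∀ y ∈ M.E, ∀ k : ℕ, 2 * k + 1 ≤ M.E.ncard →
    (M.E.ncard - 1 - k) * lowAbsorbCount M y k ≤ k * lowAbsorbCount M y (k + 1)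

/-- There is no absorbing `0`-set: `∅` absorbs `y` only if `y` is a loop, and then `E` is dependent. -/
lemma lowAbsorbCount_zero {y : α} (hy : y ∈ M.E) : lowAbsorbCount M y 0 = 0 := by
  unfold lowAbsorbCount
  rw [Set.ncard_eq_zero (hs := lowAbsorbAt_finite M y 0), Set.eq_empty_iff_forall_notMem]
  rintro Z ⟨⟨hZE, hZ0, -, hcind⟩, -, hdep⟩
  have hZ : Z = ∅ := (Set.ncard_eq_zero (M.ground_finite.subset hZE)).mp hZ0
  rw [hZ, Set.sdiff_empty] at hcind
  rw [hZ] at hdep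
  exact hdep (hcind.subset (Set.insert_subset hy (Set.empty_subset _)))

/-- **(ABS-star) ⟹ `A^y_k ≤ A^y_{k+1}` below the middle** (`2k + 1 ≤ #E`). -/
lemma lowAbsorbCount_le_succ (h : BiIndepAbsorbStar M) {y : α} (hy : y ∈ M.E) {k : ℕ}
    (hk : 2 * k + 1 ≤ M.E.ncard) : lowAbsorbCount M y k ≤ lowAbsorbCount M y (k + 1) := by
  rcases Nat.eq_zero_or_pos k with rfl | hkpos
  · rw [lowAbsorbCount_zero M hy]; exact Nat.zero_le _
  have h1 := h y hy k hk
  have h2 : k * lowAbsorbCount M y k ≤ (M.E.ncard - 1 - k) * lowAbsorbCount M y k :=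
    Nat.mul_le_mul_right _ (by omega)
  exact Nat.le_of_mul_le_mul_left (h2.trans h1) hkpos

/-- **(ABS-star) ⟹ the step of (ABS-norm)**: `(#E − k) · A^y_k ≤ (k + 1) · A^y_{k+1}` for `2k + 1 ≤ #E`. -/
lemma absorbStep_of_absorbStar (h : BiIndepAbsorbStar M) {y : α} (hy : y ∈ M.E) {k : ℕ}
    (hk : 2 * k + 1 ≤ M.E.ncard) :
    (M.E.ncard - k) * lowAbsorbCount M y k ≤ (k + 1) * lowAbsorbCount M y (k + 1) := by
  have h1 := h y hy k hk
  have h2 := lowAbsorbCount_le_succ M h hy hk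
  have hsplit : M.E.ncard - k = (M.E.ncard - 1 - k) + 1 := by omega
  rw [hsplit, add_mul, one_mul, add_mul, one_mul]
  exact Nat.add_le_add h1 h2

/-- **(ABS-star) ∧ (★★)⁺ ⟹ (ABS-norm)**: the steps and the reflection pairs are all of the normalized half rule. -/
theorem absorbNormSkew_of_absorbStar (h1 : BiIndepAbsorbStar M) (h2 : BiIndepStarPlus M) :
    BiIndepAbsorbNormSkew M := by
  intro y hy
  apply SkewConv.normSkew_of_step_of_reflect
  · intro k hk
    have hstep := absorbStep_of_absorbStar M h1 hy hk
    have hch := Nat.choose_succ_right_eq M.E.ncard k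
    refine Nat.le_of_mul_le_mul_right (c := k + 1) ?_ (Nat.succ_pos k)
    calc lowAbsorbCount M y k * M.E.ncard.choose (k + 1) * (k + 1)
        = lowAbsorbCount M y k * (M.E.ncard.choose (k + 1) * (k + 1)) := by ring
      _ = lowAbsorbCount M y k * (M.E.ncard.choose k * (M.E.ncard - k)) := by rw [hch]
      _ = ((M.E.ncard - k) * lowAbsorbCount M y k) * M.E.ncard.choose k := by ring
      _ ≤ ((k + 1) * lowAbsorbCount M y (k + 1)) * M.E.ncard.choose k := Nat.mul_le_mul_right _ hstep
      _ = lowAbsorbCount M y (k + 1) * M.E.ncard.choose k * (k + 1) := by ring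
  · intro i hi
    exact h2 y hy i hi

/-- **EVERY PAVING MATROID SATISFIES (ABS-star)**: a member at level `k` forces `r = k + 1` and `#E = 2r − 1`, and
there the step is `(r − 1) · A_{r−1} ≤ (r − 1) · A_r`, g32's injection. -/
theorem absorbStar_of_paving (h : Paving M) : BiIndepAbsorbStar M := by
  intro x hx k hk
  obtain ⟨r, hr⟩ : ∃ r : ℕ, M.eRank = r := by
    obtain ⟨k, hk⟩ := exists_eRk_eq_coe M M.E
    exact ⟨k, by rw [← M.eRk_ground]; exact hk⟩
  by_cases hAk : lowAbsorbCount M x k = 0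
  · rw [hAk, Nat.mul_zero]; exact Nat.zero_le _
  have hne : (lowAbsorbAt M x k).Nonempty := by
    by_contra hcon
    rw [Set.not_nonempty_iff_eq_empty] at hcon
    exact hAk (by unfold lowAbsorbCount; rw [hcon, Set.ncard_empty])
  obtain ⟨Z, hZ⟩ := hne
  obtain ⟨h1, h2, h3⟩ := lowAbsorbAt_bounds_of_paving M h hr hx hZ
  have hrk : r = k + 1 := by omega
  have hn : M.E.ncard = 2 * r - 1 := by omega
  have hr1 : 1 ≤ r := by omega
  have hle := ncard_lowAbsorbAt_le_of_paving M h hr hr1 hn hx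
  have hk' : k = r - 1 := by omega
  have hcoef : M.E.ncard - 1 - k = k := by omega
  rw [hcoef]
  apply Nat.mul_le_mul_left
  unfold lowAbsorbCount
  rw [hk', show r - 1 + 1 = r by omega]
  exact hle

end PercRepro
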